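import Summits.CriticalPhenomena.PercolationContinuityZ3.Theorems.PercNearOneGluingNoHeavyLowerTailAPLLightTargetsMarkov
import Literature.Probability.Percolation.TreeGraphBound
import Mathlib.Tactic.Linarith
import Mathlib.Tactic.Positivity
import Summits.CriticalPhenomena.PercolationContinuityZ3.Theorems.PercNearOneGluingNoHeavyQuantLevelTrials
import HarnessLib

/-!
# `NoHeavyLowerTail` (stmt-CriticalPhenomena-4575) — the reverse-Harris three-point row APL for LIGHT TARGETS

Support file (prover prim-ineq-prove-5 gen 38; `--supports stmt-CriticalPhenomena-4575`; memo
run/shared/lean/prim/prim-ineq-prove-5/FROM-prim-ineq-prove-5-g37-APL-STRUCTURE.md §3.3, theorem (L)).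
No definitions, no named facts, no sorries.  Part III of three (parts I–II: `…APLLightTargetsPaths`,
`…APLLightTargetsMarkov`).

SETTING.  Bond percolation `μ = prodBernoulli w` on the pairs of `Fin n`; apex `a`, targets `b, c` (distinct);
`e = P(ab|c) + P(ac|b)`, `P(b ↮ c)`, `P(a ↔ b ∪ a ↔ c)`.  The conjectured row APL(2/3) of the new-inequality
factory (prim-ineq-gen-8, CONJECTURE APL(2/3); companion file `…APLTriRegime` proves it with constant
`(2/3)·P(a|b|c)`) is `3 e ≥ 2 · P(b ↮ c) · P(a↔b ∪ a↔c)` on every finite weighted graph; Harris gives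
`e ≤ P(b ↮ c) · P(a↔b ∪ a↔c)`; the infimum of the ratio over all graphs is conjecturally `2/3` (deep hub trees).

WHAT IS PROVED HERE — the LIGHT-TARGET theorem (L) of the memo.  Let `βm ≥ P(b has an open pair into V ∖ {b,c})`,
`γm ≥ P(c has an open pair into V ∖ {b,c})`, `βm, γm ≤ 1` (the pair `{b,c}` itself may carry any weight).  Then

  `(βm + γm − 2 βm γm) · P(b ↮ c) · P(a↔b ∪ a↔c) ≤ (βm + γm − βm γm) · e`        (`apl_lightTargets`),

i.e. `Φ := e / (P(b↮c) P(a↔{b,c})) ≥ κ(βm, γm) = 1 − βm γm /(βm + γm − βm γm) ≥ 1 − min(βm, γm)`; hence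
* `apl_of_lightTarget`      : `(1 − γm) · P(b↮c) · P(a↔b ∪ a↔c) ≤ e` — ONE light target gives a constant;
* `apl_twoThirds_of_light`  : `βm, γm ≤ 1/2 ⟹ 2 · P(b ↮ c) · P(a↔b ∪ a↔c) ≤ 3 e` — the conjectured sharp
  constant `2/3` holds in the light-target regime (it is attained in the limit by the `V`-shape `b – a – c`);
* `apl_twoThirds_of_lightWeights` : the same under `Σ_{k ∉ {b,c}} w{k,b} ≤ 1/2`, `Σ_{k ∉ {b,c}} w{k,c} ≤ 1/2`
  (union bound `real_attach_le_sum`).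

PROOF (memo §3.3).  Disintegrate over `K = K0(ω)`, the open cluster of `a` in `G − {b,c}` (part II): with
`π_K = P(K0 = K)`, `β_K = P(E_b)`, `γ_K = P(E_c)`, `q_K = P(b ↮ c inside Kᶜ)`,
`P(a↔b ∪ a↔c) ≤ Σ_K π_K (β_K + γ_K − β_K γ_K)` (exit lemma), `P(b ↮ c) ≤ Σ_K π_K q_K`,
`e ≥ Σ_K π_K (β_K (1−γ_K) + γ_K (1−β_K)) q_K` (on `{K0 = K} ∩ E_b ∩ E_cᶜ ∩ Fᶜ` the cell is `ab|c`); pointwise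
`(βm+γm−βmγm)(β(1−γ) + γ(1−β)) − (βm+γm−2βmγm)(β + γ − βγ) = β βm (γm − γ) + γ γm (βm − β) ≥ 0` for
`β ≤ βm`, `γ ≤ γm`; and Harris for the two increasing functionals of the configuration
`Σ_K π_K h_K q_K ≥ (Σ_K π_K h_K)(Σ_K π_K q_K)` (part II, `harris_offCluster`).
[cite: Grimmett1999, Thm. (2.4) (Harris–FKG)] [cite: VandenbergHaggstromKahn2005, Lemma 2.3]
-/

noncomputable section

open scoped Classical

namespace Summit.CriticalPhenomena.PercolationContinuityZ3.Theorems

namespace APL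

open MeasureTheory Literature.Probability.Percolation Literature.Probability.LatticeModels
open Literature.Computation.FiniteGraph (measurableSet_of_fintype)
open Summit.CriticalPhenomena.PercolationContinuityZ3.Theorems.Quant (determinedBy_compl_of determinedBy_union_of)

/-! ### The light-target theorem -/

section Main

variable {n : ℕ}

/-- **APL for light targets** (memo theorem (L)).  For distinct `a, b, c` and any `βm, γm ≤ 1` with
`P(∃ k ∉ {b,c}, {k,b} open) ≤ βm`, `P(∃ k ∉ {b,c}, {k,c} open) ≤ γm`:
`(βm + γm − 2 βm γm) · P(b ↮ c) · P(a↔b ∪ a↔c) ≤ (βm + γm − βm γm) · (P(ab|c) + P(ac|b))`, i.e.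
`Φ ≥ κ(βm,γm) = (βm + γm − 2βmγm)/(βm + γm − βmγm)`. [this work] -/
theorem apl_lightTargets (w : Sym2 (Fin n) → unitInterval) {a b c : Fin n} (hab : a ≠ b) (hac : a ≠ c)
    (hbc : b ≠ c) {βm γm : ℝ}
    (hβ : (prodBernoulli w).real {ω : BondConfig (Fin n) | ∃ k, k ≠ b ∧ k ≠ c ∧ s(k, b) ∈ ω} ≤ βm)
    (hβ1 : βm ≤ 1)
    (hγ : (prodBernoulli w).real {ω : BondConfig (Fin n) | ∃ k, k ≠ b ∧ k ≠ c ∧ s(k, c) ∈ ω} ≤ γm)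
    (hγ1 : γm ≤ 1) :
    (βm + γm - 2 * βm * γm) *
        ((prodBernoulli w).real (openConn b c)ᶜ * (prodBernoulli w).real (openConn a b ∪ openConn a c)) ≤
      (βm + γm - βm * γm) *
        ((prodBernoulli w).real (openConn a b ∩ (openConn a c)ᶜ) +
          (prodBernoulli w).real (openConn a c ∩ (openConn a b)ᶜ)) := by
  have hm : ∀ A : Set (BondConfig (Fin n)), MeasurableSet A := fun A => measurableSet_of_fintype A
  set μ := prodBernoulli w with hμ
  set Ks := Finset.univ.filter (fun K : Finset (Fin n) => a ∈ K ∧ b ∉ K ∧ c ∉ K) with hKs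
  -- the cells of the disintegration
  set P : Finset (Fin n) → Set (BondConfig (Fin n)) := fun K =>
    {ω | openCluster (ω ∩ {e | b ∉ e ∧ c ∉ e}) a = (K : Set (Fin n))} with hP
  set Eb : Finset (Fin n) → Set (BondConfig (Fin n)) := fun K =>
    {ω | ∃ k ∈ (K : Set (Fin n)), s(k, b) ∈ ω} with hEb
  set Ec : Finset (Fin n) → Set (BondConfig (Fin n)) := fun K =>
    {ω | ∃ k ∈ (K : Set (Fin n)), s(k, c) ∈ ω} with hEc
  set F : Finset (Fin n) → Set (BondConfig (Fin n)) := fun K => openConnIn ((K : Set (Fin n))ᶜ) b c with hF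
  set π : Finset (Fin n) → ℝ := fun K => μ.real (P K) with hπ
  set β : Finset (Fin n) → ℝ := fun K => μ.real (Eb K) with hβK
  set γ : Finset (Fin n) → ℝ := fun K => μ.real (Ec K) with hγK
  set q : Finset (Fin n) → ℝ := fun K => μ.real (F K)ᶜ with hq
  have hKs_mem : ∀ K ∈ Ks, a ∈ K ∧ b ∉ K ∧ c ∉ K := fun K hK => (Finset.mem_filter.1 hK).2
  -- determination of the three events by the union class
  have hdetU : ∀ K : Finset (Fin n), DeterminedBy (Eb K ∪ Ec K)
      (↑((Finset.univ.filter fun e : Sym2 (Fin n) => ∃ k ∈ K, e = s(k, b)) ∪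
        ((Finset.univ.filter fun e : Sym2 (Fin n) => ∃ k ∈ K, e = s(k, c)) ∪
          (Finset.univ.filter fun e : Sym2 (Fin n) => ∀ x ∈ e, x ∉ K))) : Set (Sym2 (Fin n))) := by
    intro K
    rw [Finset.coe_union, Finset.coe_union]
    exact determinedBy_union_of ((determinedBy_exists_pair_finset K b).mono Set.subset_union_left)
      ((determinedBy_exists_pair_finset K c).mono
        (Set.subset_union_left.trans Set.subset_union_right))
  have hdetF : ∀ K : Finset (Fin n), DeterminedBy (F K)ᶜ
      (↑((Finset.univ.filter fun e : Sym2 (Fin n) => ∃ k ∈ K, e = s(k, b)) ∪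
        ((Finset.univ.filter fun e : Sym2 (Fin n) => ∃ k ∈ K, e = s(k, c)) ∪
          (Finset.univ.filter fun e : Sym2 (Fin n) => ∀ x ∈ e, x ∉ K))) : Set (Sym2 (Fin n))) := by
    intro K
    rw [Finset.coe_union, Finset.coe_union]
    exact determinedBy_compl_of ((determinedBy_openConnIn_compl b c K).mono
      (Set.subset_union_right.trans Set.subset_union_right))
  have hdet1 : ∀ K : Finset (Fin n), DeterminedBy (Eb K ∩ ((Ec K)ᶜ ∩ (F K)ᶜ))
      (↑((Finset.univ.filter fun e : Sym2 (Fin n) => ∃ k ∈ K, e = s(k, b)) ∪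
        ((Finset.univ.filter fun e : Sym2 (Fin n) => ∃ k ∈ K, e = s(k, c)) ∪
          (Finset.univ.filter fun e : Sym2 (Fin n) => ∀ x ∈ e, x ∉ K))) : Set (Sym2 (Fin n))) := by
    intro K
    have hF' := hdetF K
    rw [Finset.coe_union, Finset.coe_union] at hF' ⊢
    exact ((determinedBy_exists_pair_finset K b).mono Set.subset_union_left).inter
      ((determinedBy_compl_of ((determinedBy_exists_pair_finset K c).mono
        (Set.subset_union_left.trans Set.subset_union_right))).inter hF')
  have hdet2 : ∀ K : Finset (Fin n), DeterminedBy ((Eb K)ᶜ ∩ (Ec K ∩ (F K)ᶜ))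
      (↑((Finset.univ.filter fun e : Sym2 (Fin n) => ∃ k ∈ K, e = s(k, b)) ∪
        ((Finset.univ.filter fun e : Sym2 (Fin n) => ∃ k ∈ K, e = s(k, c)) ∪
          (Finset.univ.filter fun e : Sym2 (Fin n) => ∀ x ∈ e, x ∉ K))) : Set (Sym2 (Fin n))) := by
    intro K
    have hF' := hdetF K
    rw [Finset.coe_union, Finset.coe_union] at hF' ⊢
    exact (determinedBy_compl_of ((determinedBy_exists_pair_finset K b).mono Set.subset_union_left)).inter
      (((determinedBy_exists_pair_finset K c).mono
        (Set.subset_union_left.trans Set.subset_union_right)).inter hF')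
  -- (T) the connection event exits through `b` or `c`
  have hT : μ.real (openConn a b ∪ openConn a c) ≤ ∑ K ∈ Ks, π K * (β K + γ K - β K * γ K) := by
    rw [real_eq_sum_offCluster w a b c hab hac (openConn a b ∪ openConn a c)]
    refine Finset.sum_le_sum fun K hK => ?_
    obtain ⟨haK, hbK, hcK⟩ := hKs_mem K hK
    calc μ.real (P K ∩ (openConn a b ∪ openConn a c))
        ≤ μ.real (P K ∩ (Eb K ∪ Ec K)) := by
          refine measureReal_mono ?_
          rintro ω ⟨hPK, hA⟩
          refine ⟨hPK, ?_⟩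
          have hPK' : openCluster (ω ∩ {e | b ∉ e ∧ c ∉ e}) a = (K : Set (Fin n)) := hPK
          rcases hA with h | h
          · obtain ⟨k, hk, hkbc⟩ := exists_exit_of_openConn hab hac (Or.inl rfl) h
            rw [hPK'] at hk
            rcases hkbc with h1 | h1
            · exact Or.inl ⟨k, hk, h1⟩
            · exact Or.inr ⟨k, hk, h1⟩
          · obtain ⟨k, hk, hkbc⟩ := exists_exit_of_openConn hab hac (Or.inr rfl) h
            rw [hPK'] at hk
            rcases hkbc with h1 | h1
            · exact Or.inl ⟨k, hk, h1⟩
            · exact Or.inr ⟨k, hk, h1⟩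
      _ = π K * (β K + γ K - β K * γ K) := by
          rw [hπ, hβK, hγK]
          simp only []
          rw [real_offCluster_inter w a b c K haK (hdetU K), real_exitB_union_exitC w b c K hbK hbc]
  -- (B) `{b ↮ c} ⊆ {b ↮ c inside Kᶜ}`
  have hB : μ.real (openConn b c)ᶜ ≤ ∑ K ∈ Ks, π K * q K := by
    rw [real_eq_sum_offCluster w a b c hab hac (openConn b c)ᶜ]
    refine Finset.sum_le_sum fun K hK => ?_
    obtain ⟨haK, hbK, hcK⟩ := hKs_mem K hK
    calc μ.real (P K ∩ (openConn b c)ᶜ)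
        ≤ μ.real (P K ∩ (F K)ᶜ) := by
          refine measureReal_mono (Set.inter_subset_inter_right _ (Set.compl_subset_compl.2 ?_))
          exact openConnIn_subset_openConn _ b c
      _ = π K * q K := by
          rw [hπ, hq]
          exact real_offCluster_inter w a b c K haK (hdetF K)
  -- (e) on `{K0 = K} ∩ E_b ∩ E_cᶜ ∩ Fᶜ` the cell is `ab|c`; mirror for `ac|b`
  have hEq : {e : Sym2 (Fin n) | c ∉ e ∧ b ∉ e} = {e | b ∉ e ∧ c ∉ e} := by
    ext e; exact And.comm
  have he1 : ∑ K ∈ Ks, π K * (β K * ((1 - γ K) * q K)) ≤ μ.real (openConn a b ∩ (openConn a c)ᶜ) := by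
    rw [real_eq_sum_offCluster w a b c hab hac (openConn a b ∩ (openConn a c)ᶜ)]
    refine Finset.sum_le_sum fun K hK => ?_
    obtain ⟨haK, hbK, hcK⟩ := hKs_mem K hK
    calc π K * (β K * ((1 - γ K) * q K))
        = μ.real (P K ∩ (Eb K ∩ ((Ec K)ᶜ ∩ (F K)ᶜ))) := by
          rw [hπ, hβK, hγK, hq]
          simp only []
          rw [real_offCluster_inter w a b c K haK (hdet1 K), real_exitB_noExitC_noConn w b c K hbK hbc]
      _ ≤ μ.real (P K ∩ (openConn a b ∩ (openConn a c)ᶜ)) := by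
          refine measureReal_mono ?_
          rintro ω ⟨hPK, ⟨k, hk, hkb⟩, hEc, hFc⟩
          have hPK' : openCluster (ω ∩ {e | b ∉ e ∧ c ∉ e}) a = (K : Set (Fin n)) := hPK
          refine ⟨hPK, ?_, ?_⟩
          · exact openConn_of_exit (hPK'.symm ▸ hk) hkb (fun h => hbK (Finset.mem_coe.1 (h ▸ hk)))
          · refine not_openConn_of_noExit hab hac hPK' (fun k' hk' hk'c => hEc ⟨k', hk', hk'c⟩) hFc
  have he2 : ∑ K ∈ Ks, π K * ((1 - β K) * (γ K * q K)) ≤ μ.real (openConn a c ∩ (openConn a b)ᶜ) := by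
    rw [real_eq_sum_offCluster w a b c hab hac (openConn a c ∩ (openConn a b)ᶜ)]
    refine Finset.sum_le_sum fun K hK => ?_
    obtain ⟨haK, hbK, hcK⟩ := hKs_mem K hK
    calc π K * ((1 - β K) * (γ K * q K))
        = μ.real (P K ∩ ((Eb K)ᶜ ∩ (Ec K ∩ (F K)ᶜ))) := by
          rw [hπ, hβK, hγK, hq]
          simp only []
          rw [real_offCluster_inter w a b c K haK (hdet2 K), real_noExitB_exitC_noConn w b c K hbK hbc]
      _ ≤ μ.real (P K ∩ (openConn a c ∩ (openConn a b)ᶜ)) := by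
          refine measureReal_mono ?_
          rintro ω ⟨hPK, hEb, ⟨k, hk, hkc⟩, hFc⟩
          have hPK' : openCluster (ω ∩ {e | b ∉ e ∧ c ∉ e}) a = (K : Set (Fin n)) := hPK
          refine ⟨hPK, ?_, ?_⟩
          · exact openConn_of_exit (hPK'.symm ▸ hk) hkc (fun h => hcK (Finset.mem_coe.1 (h ▸ hk)))
          · have hPK'' : openCluster (ω ∩ {e | c ∉ e ∧ b ∉ e}) a = (K : Set (Fin n)) := by
              rw [hEq]; exact hPK'
            have hFc' : ω ∉ openConnIn ((K : Set (Fin n))ᶜ) c b := by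
              rw [openConnIn_comm]; exact hFc
            exact not_openConn_of_noExit hac hab hPK'' (fun k' hk' hk'b => hEb ⟨k', hk', hk'b⟩) hFc'
  -- Harris over the partition
  have hH : (∑ K ∈ Ks, π K * (β K + γ K - β K * γ K)) * (∑ K ∈ Ks, π K * q K) ≤
      ∑ K ∈ Ks, π K * ((β K + γ K - β K * γ K) * q K) := by
    have H := harris_offCluster w a b c hab hac
    have hrew : ∀ K ∈ Ks, μ.real (Eb K ∪ Ec K) = β K + γ K - β K * γ K := by
      intro K hK
      obtain ⟨-, hbK, -⟩ := hKs_mem K hK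
      rw [hβK, hγK]
      exact real_exitB_union_exitC w b c K hbK hbc
    have s1 : ∑ K ∈ Ks, π K * μ.real (Eb K ∪ Ec K) = ∑ K ∈ Ks, π K * (β K + γ K - β K * γ K) :=
      Finset.sum_congr rfl fun K hK => by rw [hrew K hK]
    have s3 : ∑ K ∈ Ks, π K * (μ.real (Eb K ∪ Ec K) * q K) =
        ∑ K ∈ Ks, π K * ((β K + γ K - β K * γ K) * q K) :=
      Finset.sum_congr rfl fun K hK => by rw [hrew K hK]
    rw [← s1, ← s3]
    exact H
  -- pointwise comparison of the two kernels
  have hβle : ∀ K ∈ Ks, β K ≤ βm := by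
    intro K hK
    obtain ⟨-, hbK, hcK⟩ := hKs_mem K hK
    refine le_trans (measureReal_mono ?_) hβ
    rintro ω ⟨k, hk, hkb⟩
    exact ⟨k, fun h => hbK (h ▸ Finset.mem_coe.1 hk), fun h => hcK (h ▸ Finset.mem_coe.1 hk), hkb⟩
  have hγle : ∀ K ∈ Ks, γ K ≤ γm := by
    intro K hK
    obtain ⟨-, hbK, hcK⟩ := hKs_mem K hK
    refine le_trans (measureReal_mono ?_) hγ
    rintro ω ⟨k, hk, hkc⟩
    exact ⟨k, fun h => hbK (h ▸ Finset.mem_coe.1 hk), fun h => hcK (h ▸ Finset.mem_coe.1 hk), hkc⟩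
  have hpt : ∀ K ∈ Ks, (βm + γm - 2 * βm * γm) * ((β K + γ K - β K * γ K) * q K) ≤
      (βm + γm - βm * γm) * (β K * ((1 - γ K) * q K) + (1 - β K) * (γ K * q K)) := by
    intro K hK
    have hb0 : 0 ≤ β K := measureReal_nonneg
    have hg0 : 0 ≤ γ K := measureReal_nonneg
    have hq0 : 0 ≤ q K := measureReal_nonneg
    have hb1 := hβle K hK
    have hg1 := hγle K hK
    -- `h1m·s − s_m·h = β βm (γm − γ) + γ γm (βm − β) ≥ 0`
    have key : (βm + γm - 2 * βm * γm) * (β K + γ K - β K * γ K) ≤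
        (βm + γm - βm * γm) * (β K * (1 - γ K) + (1 - β K) * γ K) := by
      nlinarith [mul_nonneg (mul_nonneg hb0 (le_trans hb0 hb1)) (sub_nonneg.2 hg1),
        mul_nonneg (mul_nonneg hg0 (le_trans hg0 hg1)) (sub_nonneg.2 hb1)]
    have := mul_le_mul_of_nonneg_right key hq0
    nlinarith [this]
  -- assemble
  have hsm0 : 0 ≤ βm + γm - 2 * βm * γm := by
    have hb0 : 0 ≤ βm := le_trans measureReal_nonneg hβ
    have hg0 : 0 ≤ γm := le_trans measureReal_nonneg hγ
    nlinarith [mul_nonneg hb0 (sub_nonneg.2 hγ1), mul_nonneg hg0 (sub_nonneg.2 hβ1)]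
  have hh0 : 0 ≤ βm + γm - βm * γm := by
    have hb0 : 0 ≤ βm := le_trans measureReal_nonneg hβ
    have hg0 : 0 ≤ γm := le_trans measureReal_nonneg hγ
    nlinarith [mul_nonneg hb0 (sub_nonneg.2 hγ1)]
  have hT0 : 0 ≤ μ.real (openConn a b ∪ openConn a c) := measureReal_nonneg
  have hB0 : 0 ≤ μ.real (openConn b c)ᶜ := measureReal_nonneg
  have hSq0 : 0 ≤ ∑ K ∈ Ks, π K * q K := by
    refine Finset.sum_nonneg fun K _ => ?_
    rw [hπ, hq]
    exact mul_nonneg measureReal_nonneg measureReal_nonneg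
  calc (βm + γm - 2 * βm * γm) * (μ.real (openConn b c)ᶜ * μ.real (openConn a b ∪ openConn a c))
      ≤ (βm + γm - 2 * βm * γm) *
          ((∑ K ∈ Ks, π K * q K) * (∑ K ∈ Ks, π K * (β K + γ K - β K * γ K))) := by
        refine mul_le_mul_of_nonneg_left ?_ hsm0
        exact mul_le_mul hB hT hT0 hSq0
    _ ≤ (βm + γm - 2 * βm * γm) * ∑ K ∈ Ks, π K * ((β K + γ K - β K * γ K) * q K) := by
        refine mul_le_mul_of_nonneg_left ?_ hsm0
        rw [mul_comm]
        exact hH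
    _ = ∑ K ∈ Ks, π K * ((βm + γm - 2 * βm * γm) * ((β K + γ K - β K * γ K) * q K)) := by
        rw [Finset.mul_sum]
        refine Finset.sum_congr rfl fun K _ => by ring
    _ ≤ ∑ K ∈ Ks, π K * ((βm + γm - βm * γm) * (β K * ((1 - γ K) * q K) + (1 - β K) * (γ K * q K))) :=
        Finset.sum_le_sum fun K hK => mul_le_mul_of_nonneg_left (hpt K hK) measureReal_nonneg
    _ = (βm + γm - βm * γm) *
          (∑ K ∈ Ks, π K * (β K * ((1 - γ K) * q K)) + ∑ K ∈ Ks, π K * ((1 - β K) * (γ K * q K))) := by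
        rw [← Finset.sum_add_distrib, Finset.mul_sum]
        refine Finset.sum_congr rfl fun K _ => by ring
    _ ≤ (βm + γm - βm * γm) *
          (μ.real (openConn a b ∩ (openConn a c)ᶜ) + μ.real (openConn a c ∩ (openConn a b)ᶜ)) :=
        mul_le_mul_of_nonneg_left (add_le_add he1 he2) hh0

/-- **One light target gives a constant**: `(1 − γm) · P(b ↮ c) · P(a↔b ∪ a↔c) ≤ P(ab|c) + P(ac|b)` whenever
`P(c has an open edge into V ∖ {b,c}) ≤ γm ≤ 1` (the weight of the pair `{b,c}` is unrestricted). [this work] -/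
theorem apl_of_lightTarget (w : Sym2 (Fin n) → unitInterval) {a b c : Fin n} (hab : a ≠ b) (hac : a ≠ c)
    (hbc : b ≠ c) {γm : ℝ}
    (hγ : (prodBernoulli w).real {ω : BondConfig (Fin n) | ∃ k, k ≠ b ∧ k ≠ c ∧ s(k, c) ∈ ω} ≤ γm)
    (hγ1 : γm ≤ 1) :
    (1 - γm) * ((prodBernoulli w).real (openConn b c)ᶜ * (prodBernoulli w).real (openConn a b ∪ openConn a c)) ≤
      (prodBernoulli w).real (openConn a b ∩ (openConn a c)ᶜ) +
        (prodBernoulli w).real (openConn a c ∩ (openConn a b)ᶜ) := by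
  have h := apl_lightTargets w hab hac hbc (βm := 1) measureReal_le_one le_rfl hγ hγ1
  have e1 : (1 : ℝ) + γm - 2 * 1 * γm = 1 - γm := by ring
  have e2 : (1 : ℝ) + γm - 1 * γm = 1 := by ring
  rw [e1, e2, one_mul] at h
  exact h

/-- **APL(2/3) for light targets**: if `b` and `c` each have an open edge into `V ∖ {b,c}` with probability at most
`1/2`, then `2 · P(b ↮ c) · P(a↔b ∪ a↔c) ≤ 3 · (P(ab|c) + P(ac|b))` — the conjectured sharp constant of
CONJECTURE APL(2/3) holds in this regime. [this work] -/
theorem apl_twoThirds_of_light (w : Sym2 (Fin n) → unitInterval) {a b c : Fin n} (hab : a ≠ b) (hac : a ≠ c)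
    (hbc : b ≠ c)
    (hβ : (prodBernoulli w).real {ω : BondConfig (Fin n) | ∃ k, k ≠ b ∧ k ≠ c ∧ s(k, b) ∈ ω} ≤ 1 / 2)
    (hγ : (prodBernoulli w).real {ω : BondConfig (Fin n) | ∃ k, k ≠ b ∧ k ≠ c ∧ s(k, c) ∈ ω} ≤ 1 / 2) :
    2 * ((prodBernoulli w).real (openConn b c)ᶜ * (prodBernoulli w).real (openConn a b ∪ openConn a c)) ≤
      3 * ((prodBernoulli w).real (openConn a b ∩ (openConn a c)ᶜ) +
        (prodBernoulli w).real (openConn a c ∩ (openConn a b)ᶜ)) := by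
  have h := apl_lightTargets w hab hac hbc hβ (by norm_num) hγ (by norm_num)
  norm_num at h
  linarith


/-- **Union bound for the attachment of a target**: `P(b has an open pair into V ∖ {b,c}) ≤ Σ_{k ≠ b,c} w{k,b}`.
[folklore] -/
theorem real_attach_le_sum (w : Sym2 (Fin n) → unitInterval) (b c : Fin n) :
    (prodBernoulli w).real {ω : BondConfig (Fin n) | ∃ k, k ≠ b ∧ k ≠ c ∧ s(k, b) ∈ ω} ≤
      ∑ k ∈ Finset.univ.filter (fun k : Fin n => k ≠ b ∧ k ≠ c), (w s(k, b) : ℝ) := by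
  set F := (Finset.univ.filter (fun k : Fin n => k ≠ b ∧ k ≠ c)).image (fun k => s(k, b)) with hF
  have hinj : ∀ k ∈ Finset.univ.filter (fun k : Fin n => k ≠ b ∧ k ≠ c),
      ∀ k' ∈ Finset.univ.filter (fun k : Fin n => k ≠ b ∧ k ≠ c), s(k, b) = s(k', b) → k = k' := by
    intro k hk k' _ hkk'
    rcases Sym2.eq_iff.1 hkk' with ⟨h, -⟩ | ⟨h, -⟩
    · exact h
    · exact absurd h (Finset.mem_filter.1 hk).2.1
  calc (prodBernoulli w).real {ω : BondConfig (Fin n) | ∃ k, k ≠ b ∧ k ≠ c ∧ s(k, b) ∈ ω}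
      ≤ (prodBernoulli w).real {ω : BondConfig (Fin n) | ∃ e ∈ F, e ∈ ω} := by
        refine measureReal_mono ?_
        rintro ω ⟨k, hkb, hkc, hk⟩
        exact ⟨s(k, b), Finset.mem_image.2 ⟨k, Finset.mem_filter.2 ⟨Finset.mem_univ _, hkb, hkc⟩, rfl⟩, hk⟩
    _ ≤ ∑ e ∈ F, (w e : ℝ) := prodBernoulli_real_exists_mem_le_sum w F
    _ = ∑ k ∈ Finset.univ.filter (fun k : Fin n => k ≠ b ∧ k ≠ c), (w s(k, b) : ℝ) := by
        rw [hF, Finset.sum_image hinj]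

/-- **APL(2/3) for light targets, weight form**: if the total weight of the pairs joining `b` to `V ∖ {b,c}` is at
most `1/2`, and likewise for `c` (the pair `{b,c}` itself is unrestricted), then
`2 · P(b ↮ c) · P(a↔b ∪ a↔c) ≤ 3 · (P(ab|c) + P(ac|b))`. [this work] -/
theorem apl_twoThirds_of_lightWeights (w : Sym2 (Fin n) → unitInterval) {a b c : Fin n} (hab : a ≠ b)
    (hac : a ≠ c) (hbc : b ≠ c)
    (hb : ∑ k ∈ Finset.univ.filter (fun k : Fin n => k ≠ b ∧ k ≠ c), (w s(k, b) : ℝ) ≤ 1 / 2)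
    (hc : ∑ k ∈ Finset.univ.filter (fun k : Fin n => k ≠ c ∧ k ≠ b), (w s(k, c) : ℝ) ≤ 1 / 2) :
    2 * ((prodBernoulli w).real (openConn b c)ᶜ * (prodBernoulli w).real (openConn a b ∪ openConn a c)) ≤
      3 * ((prodBernoulli w).real (openConn a b ∩ (openConn a c)ᶜ) +
        (prodBernoulli w).real (openConn a c ∩ (openConn a b)ᶜ)) := by
  refine apl_twoThirds_of_light w hab hac hbc ((real_attach_le_sum w b c).trans hb) ?_
  have hset : {ω : BondConfig (Fin n) | ∃ k, k ≠ b ∧ k ≠ c ∧ s(k, c) ∈ ω} =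
      {ω : BondConfig (Fin n) | ∃ k, k ≠ c ∧ k ≠ b ∧ s(k, c) ∈ ω} := by
    ext ω
    exact exists_congr fun k => ⟨fun ⟨h1, h2, h3⟩ => ⟨h2, h1, h3⟩, fun ⟨h1, h2, h3⟩ => ⟨h2, h1, h3⟩⟩
  rw [hset]
  exact (real_attach_le_sum w c b).trans hc

end Main

end APL

end Summit.CriticalPhenomena.PercolationContinuityZ3.Theorems

end
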